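import Literature.Barriers.QuantumAdvantage.FortnowRogersOracle
import Literature.Barriers.QuantumAdvantage.TQBFFlatStepCode
import HarnessLib

/-!
# Proof of `TQBF_isComplete_PSPACE` (Stockmeyer–Meyer; Arora–Barak 2009, Thm. 4.13)

Sibling proof file of `FortnowRogersOracle.lean` (D-0014): it discharges the named fact
`TQBF_isComplete_PSPACE` — `IsComplete PSPACE TQBF` for the tree's language `TQBF` of codes of true
closed prenex QBFs (`AaronsonChenOracle.lean`), the tree's space-machine `PSPACE` (`Space.lean`) and
Karp completeness (`Reductions.lean`) — as **`TQBF_isComplete_PSPACE_holds`**, from the formalization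
of the printed proof of Arora–Barak's Thm. 4.13 in the `TQBF*` files of this directory:

* `TQBF ∈ PSPACE`: `TQBF_mem_PSPACE` (`TQBFMembership.lean`, with `TQBFCarry.lean`,
  `TQBFCodewords.lean`): the recursive evaluation ("algorithm A", p. 111) as an orbit decider in
  polynomial space;
* `PSPACE`-hardness: `TQBFRed.isHard_PSPACE_TQBF` (`TQBFFlatStepCode.lean`, with `TQBFSavitch.lean`,
  `TQBFFlatCoding.lean`, `TQBFFlatStep.lean`, `TQBFSavitchCode.lean`): for `L ∈ PSPACE`, a flat
  presentation of a polynomial-space decider (`FlatProg.exists_flatWitness`), the prenex Savitch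
  formula `ψ_{Nc}(C_start, C_accept)` over its one-step formula (Claim 4.4), its correctness
  (`TQBFRed.mem_iff_encode_flatQBF_mem_TQBF`) and the polynomial-time computability of its code
  (`TQBFRed.codeFP_encode_flatQBF`), whence `L ≤ₚ TQBF`;

combined in `TQBFRed.isComplete_PSPACE_TQBF`. The two `TQBF` corollaries of `FortnowRogersOracle.lean` follow with
the completeness hypothesis discharged (`exists_oracle_PRel_eq_AWPPRel_infinitePH_of_TQBF_holds`,
`fortnowRogers1999_cor37_of_TQBF_holds`).

## References

* S. Arora, B. Barak, *Computational Complexity: A Modern Approach*, CUP 2009, Def. 4.9, Def. 4.10,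
  Thm. 4.13 and its proof (pp. 110–112), Claim 4.4 [AroraBarakCC2009] (held; pp. 110–113 read).
* L. J. Stockmeyer, A. R. Meyer, *Word problems requiring exponential time*, STOC 1973 (attribution).
-/

namespace Literature.Barriers.QuantumAdvantage

open _root_.Computability Literature.Computability.Complexity Literature.Computability.Complexity.Classes
  Literature.Computability.Cryptography Literature.Computability.QuantumComplexity

/-- **`TQBF` is `PSPACE`-complete** (Stockmeyer–Meyer; Arora–Barak Thm. 4.13): discharge of the
named fact `TQBF_isComplete_PSPACE` of `FortnowRogersOracle.lean`. [cite: AroraBarakCC2009, Def. 4.9 and Thm. 4.13] -/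
theorem TQBF_isComplete_PSPACE_holds : TQBF_isComplete_PSPACE :=
  TQBFRed.isComplete_PSPACE_TQBF

/-- Fortnow–Rogers' oracle-existence statement with `H = TQBF`, the `PSPACE`-completeness hypothesis
discharged: only the two generic-oracle facts remain. [cite: FortnowRogers1999JCSS, §3, proof of Cor. 3.7 (arXiv numbering)] [cite: AroraBarakCC2009, Thm. 4.13] -/
theorem exists_oracle_PRel_eq_AWPPRel_infinitePH_of_TQBF_holds (h₁ : fennerFortnowKurtzLi2003_thm618_awpp)
    (h₂ : isInfinitePHRel_join_generic) :
    ∃ A : Language Bool, PRel (Oracle.ofLanguage A) = AWPPRel (Oracle.ofLanguage A) ∧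
      IsInfinitePHRel (Oracle.ofLanguage A) :=
  exists_oracle_PRel_eq_AWPPRel_infinitePH_of_TQBF h₁ h₂ TQBF_isComplete_PSPACE_holds

/-- Cor. 3.7 with `H = TQBF`, the `PSPACE`-completeness hypothesis discharged.
[cite: FortnowRogers1999JCSS, Cor. 3.7 (arXiv numbering)] [cite: AroraBarakCC2009, Thm. 4.13] -/
theorem fortnowRogers1999_cor37_of_TQBF_holds (hBQ : BPPRel_ofLanguage_subset_BQPRel)
    (hAW : BQPRel_subset_AWPPRel) (h₁ : fennerFortnowKurtzLi2003_thm618_awpp)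
    (h₂ : isInfinitePHRel_join_generic) : fortnowRogers1999_cor37 :=
  fortnowRogers1999_cor37_of_TQBF hBQ hAW h₁ h₂ TQBF_isComplete_PSPACE_holds

end Literature.Barriers.QuantumAdvantage
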